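import Literature.Probability.LatticeModels.ProdBernoulliIndependence
import Literature.Probability.Percolation.PercolationEvents
import HarnessLib

/-!
# Set-gluing gain from the pre-FKG inequality (Kozma–Nitzan, Lemma 4 for a block of any size)

Topic `Literature/Probability/Percolation`.  Bond percolation with arbitrary edge probabilities on a
finite vertex type `V` (`μ = prodBernoulli w` on `BondConfig V = Set (Sym2 V)`), a vertex set `S`
("block"), an observer `x` and a target `b`.  Write `{x ↔ S} = ⋃_{s ∈ S} {x ↔ s}` and
`{S ↔ b} = ⋃_{s ∈ S} {s ↔ b}`; the event `{x ↮ b} ∩ {x ↔ S} ∩ {S ↔ b}` is "`S` is pivotal for the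
connection `x ↔ b`" (gluing the vertices of `S` creates the connection).

Kozma and Nitzan [KozmaNitzan2024, Lemma 4, eq. (8) p. 9, glued form (9) pp. 9–10] prove, for a block
`S = {a₁, a₂}` of size two and any vertex `a₃`,
`max_j P(S pivotal for a_j ↔ b) ≥ P(S pivotal for a₃ ↔ b)`, by three lines from their pre-FKG
inequality for two relays (Theorem 1, eq. (3) p. 2): with `a ∈ S` a relay such that
`P(x ↔ b, x ↔ S) ≥ P(a ↔ b, x ↔ S)` one gets
`P(x ↮ b, x ↔ S, S ↔ b) = P(x ↔ S, S ↔ b) − P(x ↔ b, x ↔ S) ≤ P(x ↔ S, S ↔ b) − P(a ↔ b, x ↔ S)`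
`= P(x ↔ S, S ↔ b, a ↮ b) ≤ P(S ↔ b) − P(a ↔ b)`.
The same three lines run verbatim for a block `S` of ANY size once the pre-FKG inequality
`P(x ↔ S, a ↔ b) ≤ P(x ↔ b, x ↔ S)` is available for the relay set `S` and a designated relay `a ∈ S`;
this file records exactly that conditional derivation:

* `setPivotal_add_le_of_preFKG` — `μ({x ↮ b} ∩ {x ↔ S} ∩ {S ↔ b}) + μ(g ↔ b) ≤ μ(S ↔ b)` for every `g`
  with `μ(g ↔ b) ≤ μ(a ↔ b)` (in particular the block's a-priori weakest member);
* `setPivotal_le_of_preFKG` — the same as `μ(S pivotal for x ↔ b) ≤ μ(S ↔ b) − μ(g ↔ b)`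
  ("`S` pivotal for `x ↔ b`" is at most "`S` pivotal for `g ↔ b`" when `g ∈ S`, Kozma–Nitzan's
  wording of (8)).

For `|S| = 2` the hypothesis is Kozma–Nitzan's Theorem 1 and the conclusion is their Lemma 4 / (9);
for `|S| ≥ 3` the hypothesis with `a` the marginal minimiser is an instance of their Question 7,
eq. (41) p. 36 (printed there as open; it also holds in the configurations of their Theorems 2–5),
and the conclusion ("Lemma 4 for a block") is not in print — it is DERIVED here, no claim beyond the
implication is made.  No definition and no named fact is introduced.

## References

* G. Kozma, S. Nitzan, *A reduction of the θ(p_c) = 0 problem to a conjectured inequality*,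
  arXiv:2401.12397 (2024): Theorem 1 eq. (3) p. 2; Lemma 4 eq. (8) and its proof, p. 9; Remark
  eq. (9) pp. 9–10; Question 7 eq. (41) p. 36. [KozmaNitzan2024]
-/

noncomputable section

open MeasureTheory Set Literature.Probability.LatticeModels

namespace Literature.Probability.Percolation

variable {V : Type*}

/-- **Set-gluing gain from a pre-FKG instance (additive form).**  `S` a vertex set, `a ∈ S`,
`x b g` vertices; if `μ({x ↔ S} ∩ {a ↔ b}) ≤ μ({x ↔ b} ∩ {x ↔ S})` (the pre-FKG inequality for the
observer `x`, relay set `S`, designated relay `a`) and `μ(g ↔ b) ≤ μ(a ↔ b)`, then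
`μ({x ↮ b} ∩ {x ↔ S} ∩ {S ↔ b}) + μ(g ↔ b) ≤ μ(S ↔ b)`.  Proof = Kozma–Nitzan's derivation
"Theorem 1 ⟹ Lemma 4" run for a block of arbitrary size:
`μ(x↮b, x↔S, S↔b) = μ(x↔S, S↔b) − μ(x↔b, x↔S) ≤ μ(x↔S, S↔b) − μ(x↔S, a↔b) = μ(x↔S, S↔b, a↮b)`
`≤ μ(S↔b, a↮b) = μ(S↔b) − μ(a↔b) ≤ μ(S↔b) − μ(g↔b)`.
[cite: KozmaNitzan2024, Lemma 4 (p. 9), eq. (8)–(9), proof p. 9 — corollary, derived in this file for a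
block of arbitrary size] -/
theorem setPivotal_add_le_of_preFKG [Fintype V] (w : Sym2 V → unitInterval) (x b a g : V)
    (S : Set V) (ha : a ∈ S)
    (h41 : (prodBernoulli w).real ((⋃ s ∈ S, openConn x s) ∩ openConn a b) ≤
      (prodBernoulli w).real (openConn x b ∩ ⋃ s ∈ S, openConn x s))
    (hg : (prodBernoulli w).real (openConn g b) ≤ (prodBernoulli w).real (openConn a b)) :
    (prodBernoulli w).real ((openConn x b)ᶜ ∩ (⋃ s ∈ S, openConn x s) ∩ ⋃ s ∈ S, openConn s b) +
        (prodBernoulli w).real (openConn g b) ≤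
      (prodBernoulli w).real (⋃ s ∈ S, openConn s b) := by
  set μ := prodBernoulli w with hμ
  set XS : Set (BondConfig V) := ⋃ s ∈ S, openConn x s with hXS
  set SB : Set (BondConfig V) := ⋃ s ∈ S, openConn s b with hSB
  -- `{x ↔ b} ∩ {x ↔ S} ⊆ {S ↔ b}` and `{a ↔ b} ⊆ {S ↔ b}`
  have h1 : (openConn x b : Set (BondConfig V)) ∩ XS ⊆ SB := by
    rintro ω ⟨hxb, hxS⟩
    obtain ⟨s, hs, hxs⟩ := mem_iUnion₂.1 hxS
    have hxb' : (openGraph ω).Reachable x b := hxb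
    have hxs' : (openGraph ω).Reachable x s := hxs
    exact mem_iUnion₂.2 ⟨s, hs, hxs'.symm.trans hxb'⟩
  have h2 : (openConn a b : Set (BondConfig V)) ⊆ SB := fun ω hω => mem_iUnion₂.2 ⟨a, ha, hω⟩
  -- mass bookkeeping (all sets are measurable: `BondConfig V` is finite)
  have d1 : μ.real (XS ∩ SB ∩ openConn x b) + μ.real ((XS ∩ SB) \ openConn x b) =
      μ.real (XS ∩ SB) :=
    measureReal_inter_add_sdiff MeasurableSet.of_discrete (measure_ne_top _ _)
  have d2 : μ.real (SB ∩ openConn a b) + μ.real (SB \ openConn a b) = μ.real SB :=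
    measureReal_inter_add_sdiff MeasurableSet.of_discrete (measure_ne_top _ _)
  have d3 : μ.real (XS ∩ SB ∩ openConn a b) + μ.real ((XS ∩ SB) \ openConn a b) =
      μ.real (XS ∩ SB) :=
    measureReal_inter_add_sdiff MeasurableSet.of_discrete (measure_ne_top _ _)
  have e1 : XS ∩ SB ∩ openConn x b = openConn x b ∩ XS := by
    ext ω
    constructor
    · rintro ⟨⟨hXS', -⟩, hxb⟩
      exact ⟨hxb, hXS'⟩
    · rintro ⟨hxb, hXS'⟩
      exact ⟨⟨hXS', h1 ⟨hxb, hXS'⟩⟩, hxb⟩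
  have e2 : (XS ∩ SB) \ openConn x b = (openConn x b)ᶜ ∩ XS ∩ SB := by
    ext ω
    simp only [mem_sdiff, mem_inter_iff, mem_compl_iff]
    tauto
  have e3 : SB ∩ openConn a b = openConn a b := inter_eq_right.2 h2
  have e4 : XS ∩ SB ∩ openConn a b = XS ∩ openConn a b := by
    ext ω
    constructor
    · rintro ⟨⟨hXS', -⟩, hab⟩
      exact ⟨hXS', hab⟩
    · rintro ⟨hXS', hab⟩
      exact ⟨⟨hXS', h2 hab⟩, hab⟩
  have m1 : μ.real ((XS ∩ SB) \ openConn a b) ≤ μ.real (SB \ openConn a b) :=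
    measureReal_mono (sdiff_subset_sdiff_left inter_subset_right) (measure_ne_top _ _)
  rw [e1, e2] at d1
  rw [e3] at d2
  rw [e4] at d3
  linarith

/-- **Set-gluing gain from a pre-FKG instance (Kozma–Nitzan's form (8)/(9) for a block).**  Under the
hypotheses of `setPivotal_add_le_of_preFKG`:
`μ({x ↮ b} ∩ {x ↔ S} ∩ {S ↔ b}) ≤ μ(S ↔ b) − μ(g ↔ b)`; for `g ∈ S` the right-hand side is
`μ({S ↔ b} ∩ {g ↮ b}) = μ(S pivotal for g ↔ b)`, and after gluing `S` (Remark, eq. (9)) it reads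
`μ_{G/S}(x ↔ b) − μ_G(x ↔ b) ≤ μ_G(S ↔ b) − μ_G(g ↔ b)`.
[cite: KozmaNitzan2024, Lemma 4 and Remark, eq. (9) (pp. 9–10) — corollary, derived in this file] -/
theorem setPivotal_le_of_preFKG [Fintype V] (w : Sym2 V → unitInterval) (x b a g : V)
    (S : Set V) (ha : a ∈ S)
    (h41 : (prodBernoulli w).real ((⋃ s ∈ S, openConn x s) ∩ openConn a b) ≤
      (prodBernoulli w).real (openConn x b ∩ ⋃ s ∈ S, openConn x s))
    (hg : (prodBernoulli w).real (openConn g b) ≤ (prodBernoulli w).real (openConn a b)) :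
    (prodBernoulli w).real ((openConn x b)ᶜ ∩ (⋃ s ∈ S, openConn x s) ∩ ⋃ s ∈ S, openConn s b) ≤
      (prodBernoulli w).real (⋃ s ∈ S, openConn s b) - (prodBernoulli w).real (openConn g b) := by
  have h := setPivotal_add_le_of_preFKG w x b a g S ha h41 hg
  linarith

end Literature.Probability.Percolation

end
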